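import Summits.QuantumFields.BalabanUV.Beta.GAN24.WrecAtEvenHalfRowsOfQLCSymLeg
import Summits.QuantumFields.BalabanUV.Beta.GAN24.CombChargeParityOddLiteral

/-!
# `BalabanUV.Beta.GAN24.WrecAtEvenHalfRowsOfQLCEvenClasses` — binder row G-an2-4 ∕ (CONV-C), W-slot EXIT (α): **ROAD FP's D1 LITERAL OF RECORD ⟸ THE (Q-L) LEG LETTERS AND DRIFTS
# ∧ THE LEG-SUMMED BOND-SYMMETRISED CHARGE CONSERVATION AT LEVELS ≥ 1 ON THE EVEN-CLASS PATTERNS ONLY** (the 40 patterns `(κκ′;κ₁κ₂)` in which EVERY direction occurs an even number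
# of times: the two-pair class `{a,a,b,b}` (36) and the all-equal class (4)) — MY (D) `WrecAtEvenHalfRowsOfQLCSymLeg` §3 with its display `hZ₂` DISCHARGED on the 216 odd-axis
# patterns by MY `CombChargeParityOddLiteral.zsymLegSym_conserved_succ_of_oddAxis` (an2's quartic reflection law twinned to the table level + the parity files)
# (road-P2 chair of row G-an2-4, unit `b2b-balaban-gan24-p2` gen 48, crux team (2))

NOT IN PRINT; OUR BOOKKEEPING ([folklore] one case split BY NAME; 0 `def`, 0 cited facts, 0 `def … : Prop`, 0 sorry).  HONEST FRAMING (cell contract, verbatim): «discharging `BetaPertH`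
makes Bałaban's UV stability UNCONDITIONAL — a real constructive-QFT result; it is NOT the continuum limit and NOT the Clay problem.»  HONEST DEPENDENCY (verbatim): «continuum YM on T⁴
⇐ BetaPertH ∧ nine spine estimates (0/9 proved); BetaPertH ⇐ (D1) ∧ (D4) ∧ CAP+tail; G-an2-4 gates asym, D1 and NE2/3/4.»

WHAT.  **`exists_allScalesSeq_JsRowD1Pin_of_QL_zsymLegSymEvenClasses`**: the binders of (D) §3 `exists_allScalesSeq_JsRowD1Pin_of_QL_zsymLegSymConservedSucc` VERBATIM except that
`hZ₂` (∀ patterns) becomes **`hZeven : ∀ l κ κ′ κ₁ κ₂, (¬ ∃ α, ε_κ ε_κ′ ε_κ₁ ε_κ₂ = −1) → [the same conservation equation]`** — the (C) display of the D1 literal is now OWED ON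
THE TWO-PAIR AND ALL-EQUAL CLASSES ONLY (the (TL) programme's live targets: leaf-06's EX side, leaf-02's CT sectors, leaf-04's dead words, an2's site law); §2 **`…_of_QL_rowCLegSymEvenClasses`**: the same over (D) §2 in `rowC` currency (`hC₂even`).  Discharges NOTHING of
(Q-L) ∕ (H1♮) ∕ those 40 rows ∕ (hW, hWall); (β) of record untouched; NOT «(C) closed», NEVER «G-an2-4 closed» as (CONV-C); NOT D1, NOT `BetaPertH`, NOT continuum, NOT Clay.
2026-08-23; no existing file touched.
-/

noncomputable section

open Finset
open scoped BigOperators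
open Literature.MathematicalPhysics.QuantumFieldTheory
open Literature.MathematicalPhysics.QuantumFieldTheory.Balaban1983to89
open Literature.MathematicalPhysics.QuantumFieldTheory.Balaban1983to89.Beta
open ExpKernelCalculus (MKer shiftK BiLoc Decays comp)
open OneStepResolventKernel (Fib LocStencil)
open OneStepKernelFamily (KInvStep TbalOf)
open RemainderConstAllScales (AllScalesSeq)
open AveragingContoursRooted (ctrOff ctrOff_mem_box)
open WilsonVertex2Sym (wsym22)
open AffineAveraging (box toSite unitVec)
open AveragingMixedJetTables (mixFFAt)
open SecondOrderResponse (W2SymOfK)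
open KernelWard (divV)
open BalabanCompositeJets (LocStencil₂)
open BalabanStepJetsSucc (mmRead)
open BalabanStepW2 (K3OfK M2Of)
open Summit.QuantumFields.BalabanUV.Beta.TameKernelCalculus (trK)
open Summit.QuantumFields.BalabanUV.Beta.BorderedHessian (sgnK diagK)
open Summit.QuantumFields.BalabanUV.Beta.AveragingWardRootedStencils (legInd)
open Summit.QuantumFields.BalabanUV.Beta.HessKerDressedUnits (unitK unitS)
open Summit.QuantumFields.BalabanUV.Beta.SecondOrderUnits (unitM unitS₂ unitM₂)
open Summit.QuantumFields.BalabanUV.Beta.AxialDressingRooted (coDressKBmAt)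
open Summit.QuantumFields.BalabanUV.Beta.SpineRooted (T2RecOf T2RecAt SpureRecAt M1At e3OfK)
open Summit.QuantumFields.BalabanUV.Beta.SecondOrderSocketIdentification (vh₂SAn1 vh₂SAn1_inl_inl vh₂SAn1_inr_inr)
open Summit.QuantumFields.BalabanUV.Beta.SecondOrderTableLawEnd (locStencil₂_vh₂SAn1 vh₂SAn1_translate)
open Summit.QuantumFields.BalabanUV.Beta.RowD1JointEnd (JsRowD1Pin)
open Summit.QuantumFields.BalabanUV.Beta.GAN24.CombesThomas (sfStep smStep)
open Summit.QuantumFields.BalabanUV.Beta.GAN24.T2RecursionAffine (lin4)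
open Summit.QuantumFields.BalabanUV.Beta.GAN24.BiStencilZeroMode (zmode)
open Summit.QuantumFields.BalabanUV.Beta.GAN24.T2ShapeEvenMemberOfWardLetters (t2ShapeEven_three_of_wardLetters_junction)
open Summit.QuantumFields.BalabanUV.Beta.GAN24.T2DriftEvenMemberOfWardLetters (t2DriftEven_three_of_wardLetters_junction)
open Summit.QuantumFields.BalabanUV.Beta.GAN24.WrecAtEvenHalfRowsFinal (exists_allScalesSeq_JsRowD1Pin_of_T2ev)

open OneStepResolventKernel (LocStencil)
open ExpKernelCalculus (VertexFamily)
open BalabanStepJetsSucc (wVH)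
open BalabanStepW2 (wM1 wB2)
open AveragingHessianKernelsRooted (vhSAt)
open Summit.QuantumFields.BalabanUV.Beta.BorderedHessian (stepScale)
open Summit.QuantumFields.BalabanUV.Beta.SpineRecursiveParity (parityOdd_smul parityOdd_zero)
open Summit.QuantumFields.BalabanUV.Beta.BorderWardSiteLaw (bondWardB)
open Summit.QuantumFields.BalabanUV.Beta.WardLettersUnpacking (hBord0_of_bondWard hBord0''_of_bondWard)
open Summit.QuantumFields.BalabanUV.Beta.MixedWardPacking (RWof)
open Summit.QuantumFields.BalabanUV.Beta.MixedWardSiteLaw (mixedWardBinders)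
open Summit.QuantumFields.BalabanUV.Beta.WardLocusParityLevels (smul_sum_divV_smul M1At_eq_smul_zero_level M2Of_apply comm_smul residual_law_smul vertexFamily_smul cH_mul_wM2)
open Summit.QuantumFields.BalabanUV.Beta.SymWardLettersAn1 (border_level_succ)
open Summit.QuantumFields.BalabanUV.Beta.GAN24.WrecAtEvenHalfRowsOfQLCharge (exists_allScalesSeq_JsRowD1Pin_of_QL_charge)
open Summit.QuantumFields.BalabanUV.Beta.GAN24.RowCChargeFormsLegSym (hC_evenMember_of_CSymLeg_three zsym_relSource_even_of_rowCLegSym)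
open Summit.QuantumFields.BalabanUV.Beta.GAN24.RowCLevelZero (rowC_level_zero)
open Summit.QuantumFields.BalabanUV.Beta.GAN24.T2RecChargeStep (zmodeSym_sourceB_eq)
open Summit.QuantumFields.BalabanUV.Beta.GAN24.T2RecChargeLedger (charge_factor_eq_one_of_pinEq)
open Summit.QuantumFields.BalabanUV.Beta.GAN24.RowCChargeForms (zmode_pi_sub)

open Summit.QuantumFields.BalabanUV.Beta.GAN24.WrecAtEvenHalfRowsOfQLCSymLeg (exists_allScalesSeq_JsRowD1Pin_of_QL_zsymLegSymConservedSucc exists_allScalesSeq_JsRowD1Pin_of_QL_rowCLegSymSucc)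
open Summit.QuantumFields.BalabanUV.Beta.GAN24.CombChargeParityOddLiteral (zsymLegSym_conserved_succ_of_oddAxis)
open PolarizationSign (reflSign)

namespace Summit.QuantumFields.BalabanUV.Beta.GAN24.WrecAtEvenHalfRowsOfQLCEvenClasses

variable {Lc : ℕ} [NeZero Lc]

/-- NOT IN PRINT; OUR BOOKKEEPING.  §0 **THE `rowC` DISPLAY ON THE ODD-AXIS PATTERNS** (the capstones' spelling): for every `l` and every pattern with an axis of odd multiplicity the `hC₂`
equation of (D) §2 holds — `CombChargeParityOddLiteral.zsymLegSym_conserved_succ_of_oddAxis` through MY g36 `T2RecChargeStep.zmodeSym_sourceB_eq` at the pin ((D) §3's six-line conversion). -/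
theorem rowCLegSym_succ_of_oddAxis (hLc : Odd Lc) {N : ℕ} (hN : 2 ≤ N) {r : Fin (3 + 1) → ℕ} (hr : r = ctrOff (3 + 1) Lc)
    {cE cVH cΛ cE₂ cB : ℝ} (hcE : cE = (Lc : ℝ) ^ (3 + 1)) (hcVH : cVH = -((Lc : ℝ) ^ (3 + 1) * (1 / 2) * (Lc : ℝ) ^ (3 + 1))) (hcΛ : cΛ = 2 / (Lc : ℝ) ^ 4) (hcE₂ : cE₂ = (Lc : ℝ) ^ (2 * (3 + 1)))
    (hcB : cB = -((Lc : ℝ) ^ 12 / 4)) {Tc : Fin 4 → Fin 4 → Fin 4 → Fin 4 → ℝ} (hTc : Tc = (8 * (N : ℝ) ^ 2)⁻¹ • WilsonVertex2Sym.wsym22 N)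
    {vh₂S : Fin (3 + 1) → (Fin (3 + 1) → ℤ) → Fin (3 + 1) → (Fin (3 + 1) → ℤ) → MKer (3 + 1) (Fib 3)} (hvh : vh₂S = SecondOrderSocketIdentification.vh₂SAn1 Lc)
    (l : ℕ) {κ κ' κ₁ κ₂ : Fin (3 + 1)} (hodd : ∃ α : Fin 4, reflSign α κ * reflSign α κ' * reflSign α κ₁ * reflSign α κ₂ = -1) :
          (zmode Lc ((unitS₂ (sfStep Lc ((l + 1) + 1)) (smStep 3 Lc ((l + 1) + 1)) (T2RecAt 3 Lc (toSite r) cE cVH cΛ cE₂ cB Tc vh₂S (mixFFAt (toSite r) Lc) ((l + 1) + 1)))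
                 - lin4 (cE₂ * (Lc : ℝ) ^ (2 * (3 + 1))) (unitK (sfStep Lc (l + 1)) (smStep 3 Lc (l + 1)) (KInvStep (d := 3) Lc (l + 1))) Lc
                   (unitS₂ (sfStep Lc (l + 1)) (smStep 3 Lc (l + 1)) (T2RecAt 3 Lc (toSite r) cE cVH cΛ cE₂ cB Tc vh₂S (mixFFAt (toSite r) Lc) (l + 1)))) κ κ' (Sum.inl κ₁) (Sum.inl κ₂)
             + zmode Lc ((unitS₂ (sfStep Lc ((l + 1) + 1)) (smStep 3 Lc ((l + 1) + 1)) (T2RecAt 3 Lc (toSite r) cE cVH cΛ cE₂ cB Tc vh₂S (mixFFAt (toSite r) Lc) ((l + 1) + 1)))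
                 - lin4 (cE₂ * (Lc : ℝ) ^ (2 * (3 + 1))) (unitK (sfStep Lc (l + 1)) (smStep 3 Lc (l + 1)) (KInvStep (d := 3) Lc (l + 1))) Lc
                   (unitS₂ (sfStep Lc (l + 1)) (smStep 3 Lc (l + 1)) (T2RecAt 3 Lc (toSite r) cE cVH cΛ cE₂ cB Tc vh₂S (mixFFAt (toSite r) Lc) (l + 1)))) κ' κ (Sum.inl κ₁) (Sum.inl κ₂))
          + (zmode Lc ((unitS₂ (sfStep Lc ((l + 1) + 1)) (smStep 3 Lc ((l + 1) + 1)) (T2RecAt 3 Lc (toSite r) cE cVH cΛ cE₂ cB Tc vh₂S (mixFFAt (toSite r) Lc) ((l + 1) + 1)))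
                 - lin4 (cE₂ * (Lc : ℝ) ^ (2 * (3 + 1))) (unitK (sfStep Lc (l + 1)) (smStep 3 Lc (l + 1)) (KInvStep (d := 3) Lc (l + 1))) Lc
                   (unitS₂ (sfStep Lc (l + 1)) (smStep 3 Lc (l + 1)) (T2RecAt 3 Lc (toSite r) cE cVH cΛ cE₂ cB Tc vh₂S (mixFFAt (toSite r) Lc) (l + 1)))) κ κ' (Sum.inl κ₂) (Sum.inl κ₁)
             + zmode Lc ((unitS₂ (sfStep Lc ((l + 1) + 1)) (smStep 3 Lc ((l + 1) + 1)) (T2RecAt 3 Lc (toSite r) cE cVH cΛ cE₂ cB Tc vh₂S (mixFFAt (toSite r) Lc) ((l + 1) + 1)))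
                 - lin4 (cE₂ * (Lc : ℝ) ^ (2 * (3 + 1))) (unitK (sfStep Lc (l + 1)) (smStep 3 Lc (l + 1)) (KInvStep (d := 3) Lc (l + 1))) Lc
                   (unitS₂ (sfStep Lc (l + 1)) (smStep 3 Lc (l + 1)) (T2RecAt 3 Lc (toSite r) cE cVH cΛ cE₂ cB Tc vh₂S (mixFFAt (toSite r) Lc) (l + 1)))) κ' κ (Sum.inl κ₂) (Sum.inl κ₁)) = 0 := by
  have hLc1 : 1 ≤ Lc := hLc.pos
  have hr' : r ∈ box (3 + 1) Lc := hr ▸ ctrOff_mem_box hLc1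
  have hpin : cE₂ = (Lc : ℝ) ^ (3 + 5) := hcE₂.trans (by norm_num)
  have h := zsymLegSym_conserved_succ_of_oddAxis hLc hN hr hcE hcVH hcΛ hcE₂ hcB hTc hvh l hodd
  subst hvh
  obtain ⟨CB, δB, hδB, hB⟩ := locStencil₂_vh₂SAn1 hLc
  have e1 := zmodeSym_sourceB_eq (d := 3) hLc1 hr' cE cVH cΛ cE₂ cB Tc ⟨CB, δB, hδB, hB⟩ (vh₂SAn1_translate hLc1) Lc (l + 1) κ κ' κ₁ κ₂
  have e2 := zmodeSym_sourceB_eq (d := 3) hLc1 hr' cE cVH cΛ cE₂ cB Tc ⟨CB, δB, hδB, hB⟩ (vh₂SAn1_translate hLc1) Lc (l + 1) κ κ' κ₂ κ₁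
  rw [charge_factor_eq_one_of_pinEq (d := 3) (Lc := Lc) hpin, one_mul] at e1 e2
  rw [zmode_pi_sub, zmode_pi_sub, zmode_pi_sub, zmode_pi_sub, e1, e2]
  linarith

/-- NOT IN PRINT; OUR BOOKKEEPING.  **THE D1 LITERAL FROM THE (Q-L) LEG LETTERS (AND DRIFTS) AND THE CHARGE CONSERVATION ON THE EVEN-CLASS PATTERNS ONLY** (see the module docstring):
(D) §3 with `hZ₂ := ` the case split «odd axis → `zsymLegSym_conserved_succ_of_oddAxis`; even class → `hZeven`». -/
theorem exists_allScalesSeq_JsRowD1Pin_of_QL_zsymLegSymEvenClasses (hLc : Odd Lc) (hL2 : 2 ≤ Lc) {N : ℕ} (hN : 2 ≤ N) {r : Fin (3 + 1) → ℕ} (hr : r = ctrOff (3 + 1) Lc)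
    {cE cVH cΛ cE₂ cB : ℝ} (hcE : cE = (Lc : ℝ) ^ (3 + 1)) (hcVH : cVH = -((Lc : ℝ) ^ (3 + 1) * (1 / 2) * (Lc : ℝ) ^ (3 + 1))) (hcΛ : cΛ = 2 / (Lc : ℝ) ^ 4) (hcE₂ : cE₂ = (Lc : ℝ) ^ (2 * (3 + 1)))
    (hcB : cB = -((Lc : ℝ) ^ 12 / 4)) {Tc : Fin 4 → Fin 4 → Fin 4 → Fin 4 → ℝ} (hTc : Tc = (8 * (N : ℝ) ^ 2)⁻¹ • wsym22 N)
    {vh₂S : Fin (3 + 1) → (Fin (3 + 1) → ℤ) → Fin (3 + 1) → (Fin (3 + 1) → ℤ) → MKer (3 + 1) (Fib 3)} (hvh : vh₂S = vh₂SAn1 Lc)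
    {CL₁ CL₂ CL₁' CL₂' θL δ : ℝ} (hδ : 0 < δ) (hθL0 : 0 ≤ θL) (hθL1 : θL < 1)
    (hL₁ : ∀ l, LocStencil₂ (fun κ u κ' u' => fun (p z : Fin (3 + 1) → ℤ) (_ : Fib 3) (b : Fib 3) =>
      ∑ β : Fin (3 + 1), ((((1 : ℝ) / 2) • (unitS₂ (sfStep Lc l) (smStep 3 Lc l) (T2RecAt 3 Lc (toSite r) cE cVH cΛ cE₂ cB Tc vh₂S (mixFFAt (toSite r) Lc) l)
        + (1 : ℝ) • fun κ u κ' u' => sgnK (trK ((unitS₂ (sfStep Lc l) (smStep 3 Lc l) (T2RecAt 3 Lc (toSite r) cE cVH cΛ cE₂ cB Tc vh₂S (mixFFAt (toSite r) Lc) l))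
          κ u κ' u')))) κ u κ' u' p z (Sum.inl β) b
        - (((1 : ℝ) / 2) • (unitS₂ (sfStep Lc l) (smStep 3 Lc l) (T2RecAt 3 Lc (toSite r) cE cVH cΛ cE₂ cB Tc vh₂S (mixFFAt (toSite r) Lc) l)
        + (1 : ℝ) • fun κ u κ' u' => sgnK (trK ((unitS₂ (sfStep Lc l) (smStep 3 Lc l) (T2RecAt 3 Lc (toSite r) cE cVH cΛ cE₂ cB Tc vh₂S (mixFFAt (toSite r) Lc) l))
          κ u κ' u')))) κ u κ' u' (p - unitVec β) z (Sum.inl β) b)) CL₁ δ)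
    (hL₂ : ∀ l, LocStencil₂ (fun κ u κ' u' => fun (x p : Fin (3 + 1) → ℤ) (a : Fib 3) (_ : Fib 3) =>
      ∑ β : Fin (3 + 1), ((((1 : ℝ) / 2) • (unitS₂ (sfStep Lc l) (smStep 3 Lc l) (T2RecAt 3 Lc (toSite r) cE cVH cΛ cE₂ cB Tc vh₂S (mixFFAt (toSite r) Lc) l)
        + (1 : ℝ) • fun κ u κ' u' => sgnK (trK ((unitS₂ (sfStep Lc l) (smStep 3 Lc l) (T2RecAt 3 Lc (toSite r) cE cVH cΛ cE₂ cB Tc vh₂S (mixFFAt (toSite r) Lc) l))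
          κ u κ' u')))) κ u κ' u' x p a (Sum.inl β)
        - (((1 : ℝ) / 2) • (unitS₂ (sfStep Lc l) (smStep 3 Lc l) (T2RecAt 3 Lc (toSite r) cE cVH cΛ cE₂ cB Tc vh₂S (mixFFAt (toSite r) Lc) l)
        + (1 : ℝ) • fun κ u κ' u' => sgnK (trK ((unitS₂ (sfStep Lc l) (smStep 3 Lc l) (T2RecAt 3 Lc (toSite r) cE cVH cΛ cE₂ cB Tc vh₂S (mixFFAt (toSite r) Lc) l))
          κ u κ' u')))) κ u κ' u' x (p - unitVec β) a (Sum.inl β))) CL₂ δ)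
    (hL₁' : ∀ l, LocStencil₂ (fun κ u κ' u' => fun (p z : Fin (3 + 1) → ℤ) (_ : Fib 3) (b : Fib 3) =>
      ∑ β : Fin (3 + 1), (((((1 : ℝ) / 2) • (unitS₂ (sfStep Lc (l + 1)) (smStep 3 Lc (l + 1)) (T2RecAt 3 Lc (toSite r) cE cVH cΛ cE₂ cB Tc vh₂S (mixFFAt (toSite r) Lc) (l + 1))
        + (1 : ℝ) • fun κ u κ' u' => sgnK (trK ((unitS₂ (sfStep Lc (l + 1)) (smStep 3 Lc (l + 1)) (T2RecAt 3 Lc (toSite r) cE cVH cΛ cE₂ cB Tc vh₂S (mixFFAt (toSite r) Lc) (l + 1)))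
          κ u κ' u'))))
        - (((1 : ℝ) / 2) • (unitS₂ (sfStep Lc l) (smStep 3 Lc l) (T2RecAt 3 Lc (toSite r) cE cVH cΛ cE₂ cB Tc vh₂S (mixFFAt (toSite r) Lc) l)
        + (1 : ℝ) • fun κ u κ' u' => sgnK (trK ((unitS₂ (sfStep Lc l) (smStep 3 Lc l) (T2RecAt 3 Lc (toSite r) cE cVH cΛ cE₂ cB Tc vh₂S (mixFFAt (toSite r) Lc) l))
          κ u κ' u'))))) κ u κ' u' p z (Sum.inl β) b
        - ((((1 : ℝ) / 2) • (unitS₂ (sfStep Lc (l + 1)) (smStep 3 Lc (l + 1)) (T2RecAt 3 Lc (toSite r) cE cVH cΛ cE₂ cB Tc vh₂S (mixFFAt (toSite r) Lc) (l + 1))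
        + (1 : ℝ) • fun κ u κ' u' => sgnK (trK ((unitS₂ (sfStep Lc (l + 1)) (smStep 3 Lc (l + 1)) (T2RecAt 3 Lc (toSite r) cE cVH cΛ cE₂ cB Tc vh₂S (mixFFAt (toSite r) Lc) (l + 1)))
          κ u κ' u'))))
        - (((1 : ℝ) / 2) • (unitS₂ (sfStep Lc l) (smStep 3 Lc l) (T2RecAt 3 Lc (toSite r) cE cVH cΛ cE₂ cB Tc vh₂S (mixFFAt (toSite r) Lc) l)
        + (1 : ℝ) • fun κ u κ' u' => sgnK (trK ((unitS₂ (sfStep Lc l) (smStep 3 Lc l) (T2RecAt 3 Lc (toSite r) cE cVH cΛ cE₂ cB Tc vh₂S (mixFFAt (toSite r) Lc) l))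
          κ u κ' u'))))) κ u κ' u' (p - unitVec β) z (Sum.inl β) b)) (CL₁' * θL ^ l) δ)
    (hL₂' : ∀ l, LocStencil₂ (fun κ u κ' u' => fun (x p : Fin (3 + 1) → ℤ) (a : Fib 3) (_ : Fib 3) =>
      ∑ β : Fin (3 + 1), (((((1 : ℝ) / 2) • (unitS₂ (sfStep Lc (l + 1)) (smStep 3 Lc (l + 1)) (T2RecAt 3 Lc (toSite r) cE cVH cΛ cE₂ cB Tc vh₂S (mixFFAt (toSite r) Lc) (l + 1))
        + (1 : ℝ) • fun κ u κ' u' => sgnK (trK ((unitS₂ (sfStep Lc (l + 1)) (smStep 3 Lc (l + 1)) (T2RecAt 3 Lc (toSite r) cE cVH cΛ cE₂ cB Tc vh₂S (mixFFAt (toSite r) Lc) (l + 1)))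
          κ u κ' u'))))
        - (((1 : ℝ) / 2) • (unitS₂ (sfStep Lc l) (smStep 3 Lc l) (T2RecAt 3 Lc (toSite r) cE cVH cΛ cE₂ cB Tc vh₂S (mixFFAt (toSite r) Lc) l)
        + (1 : ℝ) • fun κ u κ' u' => sgnK (trK ((unitS₂ (sfStep Lc l) (smStep 3 Lc l) (T2RecAt 3 Lc (toSite r) cE cVH cΛ cE₂ cB Tc vh₂S (mixFFAt (toSite r) Lc) l))
          κ u κ' u'))))) κ u κ' u' x p a (Sum.inl β)
        - ((((1 : ℝ) / 2) • (unitS₂ (sfStep Lc (l + 1)) (smStep 3 Lc (l + 1)) (T2RecAt 3 Lc (toSite r) cE cVH cΛ cE₂ cB Tc vh₂S (mixFFAt (toSite r) Lc) (l + 1))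
        + (1 : ℝ) • fun κ u κ' u' => sgnK (trK ((unitS₂ (sfStep Lc (l + 1)) (smStep 3 Lc (l + 1)) (T2RecAt 3 Lc (toSite r) cE cVH cΛ cE₂ cB Tc vh₂S (mixFFAt (toSite r) Lc) (l + 1)))
          κ u κ' u'))))
        - (((1 : ℝ) / 2) • (unitS₂ (sfStep Lc l) (smStep 3 Lc l) (T2RecAt 3 Lc (toSite r) cE cVH cΛ cE₂ cB Tc vh₂S (mixFFAt (toSite r) Lc) l)
        + (1 : ℝ) • fun κ u κ' u' => sgnK (trK ((unitS₂ (sfStep Lc l) (smStep 3 Lc l) (T2RecAt 3 Lc (toSite r) cE cVH cΛ cE₂ cB Tc vh₂S (mixFFAt (toSite r) Lc) l))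
          κ u κ' u'))))) κ u κ' u' x (p - unitVec β) a (Sum.inl β))) (CL₂' * θL ^ l) δ)
    (hZeven : ∀ (l : ℕ) (κ κ' κ₁ κ₂ : Fin (3 + 1)), (¬ ∃ α : Fin 4, reflSign α κ * reflSign α κ' * reflSign α κ₁ * reflSign α κ₂ = -1) →
      zmode Lc (unitS₂ (sfStep Lc (l + 1 + 1)) (smStep 3 Lc (l + 1 + 1)) (T2RecAt 3 Lc (toSite r) cE cVH cΛ cE₂ cB Tc vh₂S (mixFFAt (toSite r) Lc) (l + 1 + 1))) κ κ' (Sum.inl κ₁) (Sum.inl κ₂)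
        + zmode Lc (unitS₂ (sfStep Lc (l + 1 + 1)) (smStep 3 Lc (l + 1 + 1)) (T2RecAt 3 Lc (toSite r) cE cVH cΛ cE₂ cB Tc vh₂S (mixFFAt (toSite r) Lc) (l + 1 + 1))) κ' κ (Sum.inl κ₁) (Sum.inl κ₂)
        + (zmode Lc (unitS₂ (sfStep Lc (l + 1 + 1)) (smStep 3 Lc (l + 1 + 1)) (T2RecAt 3 Lc (toSite r) cE cVH cΛ cE₂ cB Tc vh₂S (mixFFAt (toSite r) Lc) (l + 1 + 1))) κ κ' (Sum.inl κ₂) (Sum.inl κ₁)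
        + zmode Lc (unitS₂ (sfStep Lc (l + 1 + 1)) (smStep 3 Lc (l + 1 + 1)) (T2RecAt 3 Lc (toSite r) cE cVH cΛ cE₂ cB Tc vh₂S (mixFFAt (toSite r) Lc) (l + 1 + 1))) κ' κ (Sum.inl κ₂) (Sum.inl κ₁))
      = zmode Lc (unitS₂ (sfStep Lc (l + 1)) (smStep 3 Lc (l + 1)) (T2RecAt 3 Lc (toSite r) cE cVH cΛ cE₂ cB Tc vh₂S (mixFFAt (toSite r) Lc) (l + 1))) κ κ' (Sum.inl κ₁) (Sum.inl κ₂)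
        + zmode Lc (unitS₂ (sfStep Lc (l + 1)) (smStep 3 Lc (l + 1)) (T2RecAt 3 Lc (toSite r) cE cVH cΛ cE₂ cB Tc vh₂S (mixFFAt (toSite r) Lc) (l + 1))) κ' κ (Sum.inl κ₁) (Sum.inl κ₂)
        + (zmode Lc (unitS₂ (sfStep Lc (l + 1)) (smStep 3 Lc (l + 1)) (T2RecAt 3 Lc (toSite r) cE cVH cΛ cE₂ cB Tc vh₂S (mixFFAt (toSite r) Lc) (l + 1))) κ κ' (Sum.inl κ₂) (Sum.inl κ₁)
        + zmode Lc (unitS₂ (sfStep Lc (l + 1)) (smStep 3 Lc (l + 1)) (T2RecAt 3 Lc (toSite r) cE cVH cΛ cE₂ cB Tc vh₂S (mixFFAt (toSite r) Lc) (l + 1))) κ' κ (Sum.inl κ₂) (Sum.inl κ₁)))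
    (μ ν : Fin 4) :
    ∃ κ θ : ℝ, 0 ≤ θ ∧ θ < 1 ∧ AllScalesSeq (fun j => B12Beta.secondMoment (TbalOf Lc (JsRowD1Pin hLc N) j) μ ν) κ θ := by
  classical
  refine exists_allScalesSeq_JsRowD1Pin_of_QL_zsymLegSymConservedSucc hLc hL2 hN hr hcE hcVH hcΛ hcE₂ hcB hTc hvh hδ hθL0 hθL1 hL₁ hL₂ hL₁' hL₂'
    (fun l κ κ' κ₁ κ₂ => ?_) μ ν
  by_cases hodd : ∃ α : Fin 4, reflSign α κ * reflSign α κ' * reflSign α κ₁ * reflSign α κ₂ = -1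
  · exact zsymLegSym_conserved_succ_of_oddAxis hLc hN hr hcE hcVH hcΛ hcE₂ hcB hTc hvh l hodd
  · exact hZeven l κ κ' κ₁ κ₂ hodd

/-- NOT IN PRINT; OUR BOOKKEEPING.  §2 **THE SAME IN `rowC` CURRENCY**: (D) §2 `exists_allScalesSeq_JsRowD1Pin_of_QL_rowCLegSymSucc` with its display `hC₂` (leg-symmetrised one-step
conservation of the dressed comb tower's bond-symmetrised ff charge at levels ≥ 1, `RowCChargeForms`' spelling) asked ONLY on the 40 even-class patterns (`hC₂even`); on the odd-axis
patterns it is `CombChargeParityOddLiteral.zsymLegSym_conserved_succ_of_oddAxis` through MY g36 `zmodeSym_sourceB_eq` at the pin ((D) §3's six-line conversion). -/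
theorem exists_allScalesSeq_JsRowD1Pin_of_QL_rowCLegSymEvenClasses (hLc : Odd Lc) (hL2 : 2 ≤ Lc) {N : ℕ} (hN : 2 ≤ N) {r : Fin (3 + 1) → ℕ} (hr : r = ctrOff (3 + 1) Lc)
    {cE cVH cΛ cE₂ cB : ℝ} (hcE : cE = (Lc : ℝ) ^ (3 + 1)) (hcVH : cVH = -((Lc : ℝ) ^ (3 + 1) * (1 / 2) * (Lc : ℝ) ^ (3 + 1))) (hcΛ : cΛ = 2 / (Lc : ℝ) ^ 4) (hcE₂ : cE₂ = (Lc : ℝ) ^ (2 * (3 + 1)))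
    (hcB : cB = -((Lc : ℝ) ^ 12 / 4)) {Tc : Fin 4 → Fin 4 → Fin 4 → Fin 4 → ℝ} (hTc : Tc = (8 * (N : ℝ) ^ 2)⁻¹ • wsym22 N)
    {vh₂S : Fin (3 + 1) → (Fin (3 + 1) → ℤ) → Fin (3 + 1) → (Fin (3 + 1) → ℤ) → MKer (3 + 1) (Fib 3)} (hvh : vh₂S = vh₂SAn1 Lc)
    {CL₁ CL₂ CL₁' CL₂' θL δ : ℝ} (hδ : 0 < δ) (hθL0 : 0 ≤ θL) (hθL1 : θL < 1)
    (hL₁ : ∀ l, LocStencil₂ (fun κ u κ' u' => fun (p z : Fin (3 + 1) → ℤ) (_ : Fib 3) (b : Fib 3) =>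
      ∑ β : Fin (3 + 1), ((((1 : ℝ) / 2) • (unitS₂ (sfStep Lc l) (smStep 3 Lc l) (T2RecAt 3 Lc (toSite r) cE cVH cΛ cE₂ cB Tc vh₂S (mixFFAt (toSite r) Lc) l)
        + (1 : ℝ) • fun κ u κ' u' => sgnK (trK ((unitS₂ (sfStep Lc l) (smStep 3 Lc l) (T2RecAt 3 Lc (toSite r) cE cVH cΛ cE₂ cB Tc vh₂S (mixFFAt (toSite r) Lc) l))
          κ u κ' u')))) κ u κ' u' p z (Sum.inl β) b
        - (((1 : ℝ) / 2) • (unitS₂ (sfStep Lc l) (smStep 3 Lc l) (T2RecAt 3 Lc (toSite r) cE cVH cΛ cE₂ cB Tc vh₂S (mixFFAt (toSite r) Lc) l)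
        + (1 : ℝ) • fun κ u κ' u' => sgnK (trK ((unitS₂ (sfStep Lc l) (smStep 3 Lc l) (T2RecAt 3 Lc (toSite r) cE cVH cΛ cE₂ cB Tc vh₂S (mixFFAt (toSite r) Lc) l))
          κ u κ' u')))) κ u κ' u' (p - unitVec β) z (Sum.inl β) b)) CL₁ δ)
    (hL₂ : ∀ l, LocStencil₂ (fun κ u κ' u' => fun (x p : Fin (3 + 1) → ℤ) (a : Fib 3) (_ : Fib 3) =>
      ∑ β : Fin (3 + 1), ((((1 : ℝ) / 2) • (unitS₂ (sfStep Lc l) (smStep 3 Lc l) (T2RecAt 3 Lc (toSite r) cE cVH cΛ cE₂ cB Tc vh₂S (mixFFAt (toSite r) Lc) l)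
        + (1 : ℝ) • fun κ u κ' u' => sgnK (trK ((unitS₂ (sfStep Lc l) (smStep 3 Lc l) (T2RecAt 3 Lc (toSite r) cE cVH cΛ cE₂ cB Tc vh₂S (mixFFAt (toSite r) Lc) l))
          κ u κ' u')))) κ u κ' u' x p a (Sum.inl β)
        - (((1 : ℝ) / 2) • (unitS₂ (sfStep Lc l) (smStep 3 Lc l) (T2RecAt 3 Lc (toSite r) cE cVH cΛ cE₂ cB Tc vh₂S (mixFFAt (toSite r) Lc) l)
        + (1 : ℝ) • fun κ u κ' u' => sgnK (trK ((unitS₂ (sfStep Lc l) (smStep 3 Lc l) (T2RecAt 3 Lc (toSite r) cE cVH cΛ cE₂ cB Tc vh₂S (mixFFAt (toSite r) Lc) l))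
          κ u κ' u')))) κ u κ' u' x (p - unitVec β) a (Sum.inl β))) CL₂ δ)
    (hL₁' : ∀ l, LocStencil₂ (fun κ u κ' u' => fun (p z : Fin (3 + 1) → ℤ) (_ : Fib 3) (b : Fib 3) =>
      ∑ β : Fin (3 + 1), (((((1 : ℝ) / 2) • (unitS₂ (sfStep Lc (l + 1)) (smStep 3 Lc (l + 1)) (T2RecAt 3 Lc (toSite r) cE cVH cΛ cE₂ cB Tc vh₂S (mixFFAt (toSite r) Lc) (l + 1))
        + (1 : ℝ) • fun κ u κ' u' => sgnK (trK ((unitS₂ (sfStep Lc (l + 1)) (smStep 3 Lc (l + 1)) (T2RecAt 3 Lc (toSite r) cE cVH cΛ cE₂ cB Tc vh₂S (mixFFAt (toSite r) Lc) (l + 1)))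
          κ u κ' u'))))
        - (((1 : ℝ) / 2) • (unitS₂ (sfStep Lc l) (smStep 3 Lc l) (T2RecAt 3 Lc (toSite r) cE cVH cΛ cE₂ cB Tc vh₂S (mixFFAt (toSite r) Lc) l)
        + (1 : ℝ) • fun κ u κ' u' => sgnK (trK ((unitS₂ (sfStep Lc l) (smStep 3 Lc l) (T2RecAt 3 Lc (toSite r) cE cVH cΛ cE₂ cB Tc vh₂S (mixFFAt (toSite r) Lc) l))
          κ u κ' u'))))) κ u κ' u' p z (Sum.inl β) b
        - ((((1 : ℝ) / 2) • (unitS₂ (sfStep Lc (l + 1)) (smStep 3 Lc (l + 1)) (T2RecAt 3 Lc (toSite r) cE cVH cΛ cE₂ cB Tc vh₂S (mixFFAt (toSite r) Lc) (l + 1))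
        + (1 : ℝ) • fun κ u κ' u' => sgnK (trK ((unitS₂ (sfStep Lc (l + 1)) (smStep 3 Lc (l + 1)) (T2RecAt 3 Lc (toSite r) cE cVH cΛ cE₂ cB Tc vh₂S (mixFFAt (toSite r) Lc) (l + 1)))
          κ u κ' u'))))
        - (((1 : ℝ) / 2) • (unitS₂ (sfStep Lc l) (smStep 3 Lc l) (T2RecAt 3 Lc (toSite r) cE cVH cΛ cE₂ cB Tc vh₂S (mixFFAt (toSite r) Lc) l)
        + (1 : ℝ) • fun κ u κ' u' => sgnK (trK ((unitS₂ (sfStep Lc l) (smStep 3 Lc l) (T2RecAt 3 Lc (toSite r) cE cVH cΛ cE₂ cB Tc vh₂S (mixFFAt (toSite r) Lc) l))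
          κ u κ' u'))))) κ u κ' u' (p - unitVec β) z (Sum.inl β) b)) (CL₁' * θL ^ l) δ)
    (hL₂' : ∀ l, LocStencil₂ (fun κ u κ' u' => fun (x p : Fin (3 + 1) → ℤ) (a : Fib 3) (_ : Fib 3) =>
      ∑ β : Fin (3 + 1), (((((1 : ℝ) / 2) • (unitS₂ (sfStep Lc (l + 1)) (smStep 3 Lc (l + 1)) (T2RecAt 3 Lc (toSite r) cE cVH cΛ cE₂ cB Tc vh₂S (mixFFAt (toSite r) Lc) (l + 1))
        + (1 : ℝ) • fun κ u κ' u' => sgnK (trK ((unitS₂ (sfStep Lc (l + 1)) (smStep 3 Lc (l + 1)) (T2RecAt 3 Lc (toSite r) cE cVH cΛ cE₂ cB Tc vh₂S (mixFFAt (toSite r) Lc) (l + 1)))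
          κ u κ' u'))))
        - (((1 : ℝ) / 2) • (unitS₂ (sfStep Lc l) (smStep 3 Lc l) (T2RecAt 3 Lc (toSite r) cE cVH cΛ cE₂ cB Tc vh₂S (mixFFAt (toSite r) Lc) l)
        + (1 : ℝ) • fun κ u κ' u' => sgnK (trK ((unitS₂ (sfStep Lc l) (smStep 3 Lc l) (T2RecAt 3 Lc (toSite r) cE cVH cΛ cE₂ cB Tc vh₂S (mixFFAt (toSite r) Lc) l))
          κ u κ' u'))))) κ u κ' u' x p a (Sum.inl β)
        - ((((1 : ℝ) / 2) • (unitS₂ (sfStep Lc (l + 1)) (smStep 3 Lc (l + 1)) (T2RecAt 3 Lc (toSite r) cE cVH cΛ cE₂ cB Tc vh₂S (mixFFAt (toSite r) Lc) (l + 1))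
        + (1 : ℝ) • fun κ u κ' u' => sgnK (trK ((unitS₂ (sfStep Lc (l + 1)) (smStep 3 Lc (l + 1)) (T2RecAt 3 Lc (toSite r) cE cVH cΛ cE₂ cB Tc vh₂S (mixFFAt (toSite r) Lc) (l + 1)))
          κ u κ' u'))))
        - (((1 : ℝ) / 2) • (unitS₂ (sfStep Lc l) (smStep 3 Lc l) (T2RecAt 3 Lc (toSite r) cE cVH cΛ cE₂ cB Tc vh₂S (mixFFAt (toSite r) Lc) l)
        + (1 : ℝ) • fun κ u κ' u' => sgnK (trK ((unitS₂ (sfStep Lc l) (smStep 3 Lc l) (T2RecAt 3 Lc (toSite r) cE cVH cΛ cE₂ cB Tc vh₂S (mixFFAt (toSite r) Lc) l))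
          κ u κ' u'))))) κ u κ' u' x (p - unitVec β) a (Sum.inl β))) (CL₂' * θL ^ l) δ)
    (hC₂even : ∀ (l : ℕ) (κ κ' κ₁ κ₂ : Fin (3 + 1)), (¬ ∃ α : Fin 4, reflSign α κ * reflSign α κ' * reflSign α κ₁ * reflSign α κ₂ = -1) →
      (zmode Lc ((unitS₂ (sfStep Lc ((l + 1) + 1)) (smStep 3 Lc ((l + 1) + 1)) (T2RecAt 3 Lc (toSite r) cE cVH cΛ cE₂ cB Tc vh₂S (mixFFAt (toSite r) Lc) ((l + 1) + 1)))
             - lin4 (cE₂ * (Lc : ℝ) ^ (2 * (3 + 1))) (unitK (sfStep Lc (l + 1)) (smStep 3 Lc (l + 1)) (KInvStep (d := 3) Lc (l + 1))) Lc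
               (unitS₂ (sfStep Lc (l + 1)) (smStep 3 Lc (l + 1)) (T2RecAt 3 Lc (toSite r) cE cVH cΛ cE₂ cB Tc vh₂S (mixFFAt (toSite r) Lc) (l + 1)))) κ κ' (Sum.inl κ₁) (Sum.inl κ₂)
         + zmode Lc ((unitS₂ (sfStep Lc ((l + 1) + 1)) (smStep 3 Lc ((l + 1) + 1)) (T2RecAt 3 Lc (toSite r) cE cVH cΛ cE₂ cB Tc vh₂S (mixFFAt (toSite r) Lc) ((l + 1) + 1)))
             - lin4 (cE₂ * (Lc : ℝ) ^ (2 * (3 + 1))) (unitK (sfStep Lc (l + 1)) (smStep 3 Lc (l + 1)) (KInvStep (d := 3) Lc (l + 1))) Lc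
               (unitS₂ (sfStep Lc (l + 1)) (smStep 3 Lc (l + 1)) (T2RecAt 3 Lc (toSite r) cE cVH cΛ cE₂ cB Tc vh₂S (mixFFAt (toSite r) Lc) (l + 1)))) κ' κ (Sum.inl κ₁) (Sum.inl κ₂))
      + (zmode Lc ((unitS₂ (sfStep Lc ((l + 1) + 1)) (smStep 3 Lc ((l + 1) + 1)) (T2RecAt 3 Lc (toSite r) cE cVH cΛ cE₂ cB Tc vh₂S (mixFFAt (toSite r) Lc) ((l + 1) + 1)))
             - lin4 (cE₂ * (Lc : ℝ) ^ (2 * (3 + 1))) (unitK (sfStep Lc (l + 1)) (smStep 3 Lc (l + 1)) (KInvStep (d := 3) Lc (l + 1))) Lc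
               (unitS₂ (sfStep Lc (l + 1)) (smStep 3 Lc (l + 1)) (T2RecAt 3 Lc (toSite r) cE cVH cΛ cE₂ cB Tc vh₂S (mixFFAt (toSite r) Lc) (l + 1)))) κ κ' (Sum.inl κ₂) (Sum.inl κ₁)
         + zmode Lc ((unitS₂ (sfStep Lc ((l + 1) + 1)) (smStep 3 Lc ((l + 1) + 1)) (T2RecAt 3 Lc (toSite r) cE cVH cΛ cE₂ cB Tc vh₂S (mixFFAt (toSite r) Lc) ((l + 1) + 1)))
             - lin4 (cE₂ * (Lc : ℝ) ^ (2 * (3 + 1))) (unitK (sfStep Lc (l + 1)) (smStep 3 Lc (l + 1)) (KInvStep (d := 3) Lc (l + 1))) Lc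
               (unitS₂ (sfStep Lc (l + 1)) (smStep 3 Lc (l + 1)) (T2RecAt 3 Lc (toSite r) cE cVH cΛ cE₂ cB Tc vh₂S (mixFFAt (toSite r) Lc) (l + 1)))) κ' κ (Sum.inl κ₂) (Sum.inl κ₁)) = 0)
    (μ ν : Fin 4) :
    ∃ κ θ : ℝ, 0 ≤ θ ∧ θ < 1 ∧ AllScalesSeq (fun j => B12Beta.secondMoment (TbalOf Lc (JsRowD1Pin hLc N) j) μ ν) κ θ := by
  subst hvh
  refine exists_allScalesSeq_JsRowD1Pin_of_QL_rowCLegSymSucc hLc hL2 hN hr hcE hcVH hcΛ hcE₂ hcB hTc rfl hδ hθL0 hθL1 hL₁ hL₂ hL₁' hL₂'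
    (fun l κ κ' κ₁ κ₂ => ?_) μ ν
  by_cases hodd : ∃ α : Fin 4, reflSign α κ * reflSign α κ' * reflSign α κ₁ * reflSign α κ₂ = -1
  · exact rowCLegSym_succ_of_oddAxis hLc hN hr hcE hcVH hcΛ hcE₂ hcB hTc rfl l hodd
  · exact hC₂even l κ κ' κ₁ κ₂ hodd

end Summit.QuantumFields.BalabanUV.Beta.GAN24.WrecAtEvenHalfRowsOfQLCEvenClasses

end
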